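import Literature.AlgebraicTopology.FundamentalGroup.RotationGroupSO3
import Mathlib.Analysis.SpecialFunctions.SmoothTransition
import Mathlib.Analysis.Calculus.ContDiff.WithLp
import Mathlib.Analysis.InnerProductSpace.Calculus
import HarnessLib

/-!
# Smooth paths in the rotation group `SO(3)` through unit quaternions

Topic `Literature/LinearAlgebra/Matrix`.  A quantitative form of the connectedness of `SO(3)`
(Hatcher, *Algebraic Topology* (2002), §3.D: the universal cover `S³ → SO(3)`, `u ↦ (w ↦ u w u⁻¹)`,
is surjective, and `S³` is path connected): **every rotation `P ∈ SO(3)` is the endpoint of a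
`C^∞` path of rotations starting at `1` which is CONSTANT NEAR BOTH ENDS** —
`exists_contDiff_path_SO3`: `R : ℝ → M₃(ℝ)` smooth, `R(t) ∈ SO(3)` for all `t`, `R(t) = 1` for
`t ≤ 0` and `R(t) = P` for `t ≥ 1`.

Construction (no transcendental functions beyond Mathlib's `Real.smoothTransition`): lift `P`
to a unit quaternion `q` by `surjective_rotHom` (`RotationGroupSO3.lean`); if `q = -1` then
`P = 1` and the constant path works; otherwise the segment `w(s) = (1 - s) + s q` avoids `0`,
and `R(t) = |w(λ t)|⁻² · quatRot (w(λ t))` with `λ = Real.smoothTransition` is the required path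
(`quatRot` is homogeneous of degree `2`, `(quatRot w)ᵀ quatRot w = |w|⁴`, `det quatRot w = |w|⁶`).
Used to untwist the monodromy of normal frames along embedded circles (tubular neighbourhoods of
zero circles of near-symplectic forms, `Literature/Geometry/Symplectic`).

Everything is proved; no definitions, no named facts.

## References

* A. Hatcher, *Algebraic Topology*, CUP (2002), §3.D (`S³ → SO(3)` surjective). [HatcherAT2002]
-/

noncomputable section

open Set Function Matrix Quaternion
open scoped ContDiff

namespace Literature.LinearAlgebra.Matrix

open Literature.AlgebraicTopology.FundamentalGroup

/-! ### Smoothness of `quatRot` -/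

/-- The four real coordinates of a quaternion are `C^∞` functions. [folklore] -/
theorem contDiff_quaternion_coords {n : WithTop ℕ∞} :
    ContDiff ℝ n (fun q : ℍ => q.re) ∧ ContDiff ℝ n (fun q : ℍ => q.imI) ∧
      ContDiff ℝ n (fun q : ℍ => q.imJ) ∧ ContDiff ℝ n (fun q : ℍ => q.imK) :=
  ⟨(EuclideanSpace.proj (0 : Fin 4)).contDiff.comp linearIsometryEquivTuple.contDiff,
    (EuclideanSpace.proj (1 : Fin 4)).contDiff.comp linearIsometryEquivTuple.contDiff,
    (EuclideanSpace.proj (2 : Fin 4)).contDiff.comp linearIsometryEquivTuple.contDiff,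
    (EuclideanSpace.proj (3 : Fin 4)).contDiff.comp linearIsometryEquivTuple.contDiff⟩

/-- **`quatRot : ℍ → M₃(ℝ)` has `C^∞` entries** (polynomials; stated entrywise, `M₃(ℝ)`
carrying no preferred norm). [folklore] -/
theorem contDiff_quatRot_apply (i j : Fin 3) : ContDiff ℝ ∞ (fun q : ℍ => quatRot q i j) := by
  obtain ⟨h1, h2, h3, h4⟩ := contDiff_quaternion_coords (n := ∞)
  fin_cases i <;> fin_cases j <;> simp [quatRot] <;> fun_prop

/-- `normSq : ℍ → ℝ` is `C^∞` (it is `‖·‖²`). [folklore] -/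
theorem contDiff_normSq : ContDiff ℝ ∞ (fun q : ℍ => normSq q) := by
  have h : (fun q : ℍ => normSq q) = fun q : ℍ => ‖q‖ ^ 2 := by
    funext q
    rw [normSq_eq_norm_mul_self, pow_two]
  rw [h]
  exact contDiff_norm_sq ℝ

/-! ### The segment from `1` to a unit quaternion `q ≠ -1` avoids `0` -/

/-- For a unit quaternion `q ≠ -1` and `s ∈ [0, 1]`, `(1 - s) + s q ≠ 0`. [folklore] -/
theorem segment_ne_zero {q : ℍ} (hq : ‖q‖ = 1) (hq1 : q ≠ -1) {s : ℝ} (hs0 : 0 ≤ s)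
    (hs1 : s ≤ 1) : (1 - s) • (1 : ℍ) + s • q ≠ 0 := by
  intro h
  rcases eq_or_lt_of_le hs0 with rfl | hs
  · simp at h
  · -- `q = -((1 - s)/s) • 1` is real and non-positive, of norm one, hence `q = -1`
    have hq' : q = (-((1 - s) / s)) • (1 : ℍ) := by
      have h2 : s • q = -((1 - s) • (1 : ℍ)) := eq_neg_of_add_eq_zero_right h
      calc q = s⁻¹ • (s • q) := by rw [smul_smul, inv_mul_cancel₀ hs.ne', one_smul]
        _ = s⁻¹ • (-((1 - s) • (1 : ℍ))) := by rw [h2]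
        _ = (-((1 - s) / s)) • (1 : ℍ) := by
          rw [smul_neg, smul_smul, ← neg_smul, div_eq_inv_mul]
    have hnorm : ‖q‖ = |(1 - s) / s| := by
      rw [hq', norm_smul, norm_one, mul_one, Real.norm_eq_abs, abs_neg]
    rw [hq] at hnorm
    have hc : (1 - s) / s = 1 := by
      have hnn : 0 ≤ (1 - s) / s := div_nonneg (by linarith) hs.le
      rw [abs_of_nonneg hnn] at hnorm
      exact hnorm.symm
    apply hq1
    rw [hq', hc, neg_one_smul]

/-! ### The smooth path -/

/-- **Smooth paths in `SO(3)`, constant near the ends** (quantitative path-connectedness of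
`SO(3)` through its universal cover `S³`, Hatcher §3.D): for every `P ∈ SO(3)` there is a `C^∞`
map `R : ℝ → M₃(ℝ)` with `R(t)ᵀ R(t) = 1`, `det R(t) = 1` for all `t`, `R(t) = 1` for `t ≤ 0`
and `R(t) = P` for `t ≥ 1`. [cite: HatcherAT2002, §3.D] -/
theorem exists_contDiff_path_SO3 (P : SO3) :
    ∃ R : ℝ → Matrix (Fin 3) (Fin 3) ℝ, (∀ i j, ContDiff ℝ ∞ (fun t ↦ R t i j)) ∧
      (∀ t, (R t)ᵀ * R t = 1 ∧ (R t).det = 1) ∧ (∀ t, t ≤ 0 → R t = 1) ∧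
      (∀ t, 1 ≤ t → R t = P.1) := by
  obtain ⟨q, hqP⟩ := surjective_rotHom P
  have hq : ‖(q : ℍ)‖ = 1 := norm_eq_of_mem_sphere q
  have hqn : normSq (q : ℍ) = 1 := normSq_coe_sphere q
  by_cases hq1 : (q : ℍ) = -1
  · -- `P = quatRot (-1) = 1`: the constant path
    have hP : P.1 = 1 := by
      rw [← hqP, coe_rotHom, hq1, quatRot_neg, quatRot_one]
    refine ⟨fun _ ↦ 1, fun i j ↦ contDiff_const, fun t ↦ ⟨by simp, by simp⟩, fun t _ ↦ rfl,
      fun t _ ↦ ?_⟩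
    rw [hP]
  -- the segment `w s = (1 - s) + s q` and the path `R t = |w(λ t)|⁻² quatRot (w (λ t))`
  set w : ℝ → ℍ := fun s ↦ (1 - s) • (1 : ℍ) + s • (q : ℍ) with hw
  set lam : ℝ → ℝ := Real.smoothTransition with hlam
  have hwne : ∀ t, w (lam t) ≠ 0 := fun t ↦
    segment_ne_zero hq hq1 (Real.smoothTransition.nonneg t) (Real.smoothTransition.le_one t)
  have hnsq : ∀ t, normSq (w (lam t)) ≠ 0 := fun t h ↦ hwne t (normSq_eq_zero.1 h)
  set R : ℝ → Matrix (Fin 3) (Fin 3) ℝ := fun t ↦ (normSq (w (lam t)))⁻¹ • quatRot (w (lam t))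
    with hR
  have hwsm : ContDiff ℝ ∞ w :=
    ((contDiff_const.sub contDiff_id).smul contDiff_const).add (contDiff_id.smul contDiff_const)
  have hlsm : ContDiff ℝ ∞ lam := Real.smoothTransition.contDiff
  have hcomp : ContDiff ℝ ∞ (fun t ↦ w (lam t)) := hwsm.comp hlsm
  refine ⟨R, fun i j ↦ ?_, fun t ↦ ?_, fun t ht ↦ ?_, fun t ht ↦ ?_⟩
  · -- smoothness, entrywise
    show ContDiff ℝ ∞ (fun t ↦ ((normSq (w (lam t)))⁻¹ • quatRot (w (lam t))) i j)
    simp only [Matrix.smul_apply, smul_eq_mul]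
    exact ((contDiff_normSq.comp hcomp).inv hnsq).mul ((contDiff_quatRot_apply i j).comp hcomp)
  · -- values in `SO(3)`
    set c : ℝ := normSq (w (lam t)) with hc
    have hc0 : c ≠ 0 := hnsq t
    constructor
    · show ((c⁻¹ • quatRot (w (lam t)))ᵀ * (c⁻¹ • quatRot (w (lam t)))) = 1
      rw [transpose_smul, smul_mul_assoc, mul_smul_comm, transpose_quatRot_mul_self, ← hc,
        smul_smul, smul_smul]
      rw [show c⁻¹ * c⁻¹ * c ^ 2 = 1 by field_simp, one_smul]
    · show (c⁻¹ • quatRot (w (lam t))).det = 1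
      rw [det_smul, det_quatRot, ← hc, Fintype.card_fin]
      field_simp
  · -- constant `1` for `t ≤ 0`
    have hl : lam t = 0 := Real.smoothTransition.zero_of_nonpos ht
    show (normSq (w (lam t)))⁻¹ • quatRot (w (lam t)) = 1
    have hw0 : w (lam t) = 1 := by rw [hl]; simp [hw]
    rw [hw0, quatRot_one, map_one, inv_one, one_smul]
  · -- constant `P` for `1 ≤ t`
    have hl : lam t = 1 := Real.smoothTransition.one_of_one_le ht
    show (normSq (w (lam t)))⁻¹ • quatRot (w (lam t)) = P.1
    have hw1 : w (lam t) = q := by rw [hl]; simp [hw]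
    rw [hw1, hqn, inv_one, one_smul, ← hqP, coe_rotHom]

end Literature.LinearAlgebra.Matrix

end
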